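import Summits.ABC.IUTFork.Thm311RealInd1StripOrbitSpan
import Summits.ABC.IUTFork.Thm311RealInd1StripGenuineK
import HarnessLib

/-!
# [IUTchIII] Thm 3.11 (i) (Ind1) at `v ∈ 𝕍^non`, EVEN local degree: the orbit span of print's strip part reaches the plane lattices AND the
# first-pair shear `y^*_{2}(M)·y_1` (modulo `JannsenWingbergTwistsFirst`)

PROOF-ONLY file (abc-iut cell, Cor. 3.12 sub-crew, seat abc-iut-c312-1 = holder of record of the typed [IUTchIII] Thm. 3.11, gen 14; row
«R17 = C:PERIMAGE-PRINT-IND1», part c — the EVEN-degree twin of `Thm311RealInd1StripOrbitSpan` §2).  TAKES NO SIDE on [IUTchIII] Cor. 3.12.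

At `v ∣ p` odd with `d = [K_v : ℚ_p] ≥ 2` EVEN, gen 12's `Real.exists_realised_basis_trace_zero_of_jannsenWingbergFirst` (p502329; modulo the named
fact `JannsenWingbergTwistsFirst` = Jannsen–Wingberg 1982 §5.1 `n = 2` / Hoshi–Nishio 2022 Thm 1.5 / Kondo 2025 proof of Thm 2.3, even case)
gives ONE `ℚ_p`-basis `y : Fin 2 ⊕ Fin g × Fin 2` of `K_v^{(1/n_v)}` (`d = 2 + 2g`; Kondo's `y_1 = y_{inl 0}`, `y_2 = y_{inl 1}`, planes
`(y_{(i,0)}, y_{(i,1)})`), with `y_{inl 0}` and all plane vectors trace-zero, and REALISED in print's (Ind1) strip part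
`Real.ind1StripOf v (galoisLog v)`: the first-pair shear `ψ₀ : x ↦ x + y^*_{inl 1}(x)·y_{inl 0}` and the plane transvections `ψ_i, ψ'_i`.
* **`exists_shear_planes_smul_mem_of_orbit`** — for every subset `M ⊆ K_v` and every additive subgroup `N` of `K_v^{(1/n_v)}` containing the
  images of `M` under `1, ψ₀, ψ_i, ψ'_i, ψ'_i ∘ ψ_i, ψ_i ∘ ψ'_i`: `y^*_{inl 1}(x)·y_{inl 0} ∈ N` and `y^*_{(i,ε)}(x)·y_{(i,ε')} ∈ N` for all
  `x ∈ M`, `i`, `ε, ε'` — the additive span of the strip orbit of `M` contains `M + C_⊥(M)·ℤy_{inl 0} + Σ_i C_i(M)·P_i`, where `C_⊥(M)` are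
  the `y_{inl 1}`-coordinates of `M` (the NON-trace-zero direction: `Tr(x) = y^*_{inl 1}(x)·Tr(y_{inl 1})`) and `C_i(M)` the plane coordinates.
  All reached vectors are trace-zero, inside the unconditional ceiling `M + c·(log_p(𝒪_v^×) ∩ Ker Tr)` of `Thm311RealInd1StripOrbitSpan` §1.
* §2 **`orbitSpan_at_bad_of_jannsenWingberg`** — the JUNCTION with [IUTchI] Def. 3.1 (abc-iut-L5-t2 `InitialThetaData`, abc-iut-C-cert-3
  `pilotDataOfK`, R16): at EVERY bad place `w` of a genuine initial Θ-datum (`p ≠ 2`, `[K_w : ℚ_p] ≥ 5` automatic) the orbit span of print's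
  (Ind1) strip part reaches the shear + plane data (even `[K_w : ℚ_p]`, mod `JannsenWingbergTwistsFirst`) resp. the plane data spanning `Ker Tr`
  (odd, mod `JannsenWingbergTwists`, R17b `exists_planes_smul_mem_of_orbit`).
READING (numbers about OUR typed objects): at even local degree print's (Ind1) strip part converts the TRACE content of a region into
trace-zero reach (`C_⊥(M)·y_{inl 0}`) in addition to the plane reach — one more direction than at odd degree, where the residual vector
`y_1` is not known to be moved by any automorphism (Kondo 2025 p. 5). HONEST SCOPE: conditional on `hJW : JannsenWingbergTwistsFirst`
(binder); single place; nothing here computes a hull or a log-volume; no side taken on [IUTchIII] Cor. 3.12; NO abc claim.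
[claim: Mochizuki2012, status: disputed]; [cite: Kondo2025OuterAutMLF, §2 proof of Thm 2.3 p.10, Lemma 2.5]; [cite: HoshiNishio2022OuterAutMLF, Thm 1.5,
Lemma 2.3 (ii)]; [cite: JannsenWingberg1982, §5.1 p.96]; [cite: DupuyHilado2025, §4.9]. typed ≠ proved; a conditional theorem discharges nothing it binds.
-/

set_option autoImplicit false

noncomputable section

open Metric Set
open scoped Pointwise

namespace Summit.ABC.IUTFork.Thm311.Real

open NumberField IsDedekindDomain Literature.NumberTheory.NumberFields Literature.IUT.LogVolume
open Literature.NumberTheory.GaloisRepresentations Literature.NumberTheory.GaloisRepresentations.Ultrametric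
open Literature.AnabelianGeometry.AbsoluteAnabelian Literature.IUT.HodgeArakelov
open Literature.IUT.HodgeArakelov.AbsTopMonoids Literature.IUT.LogThetaLattice

variable {F : Type} [Field F] [NumberField F] (v : HeightOneSpectrum (𝓞 F))

/-- **THE ORBIT SPAN OF PRINT's (Ind1) STRIP PART, EVEN local degree (modulo `JannsenWingbergTwistsFirst`).**  At `v ∣ p` odd with
`d = [K_v : ℚ_p] ≥ 2` EVEN there are `g` with `d = 2 + 2g`, a `ℚ_p`-basis `y : Fin 2 ⊕ Fin g × Fin 2` of `K_v^{(1/n_v)}` with `y_{inl 0}` and every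
plane vector trace-zero, the first-pair shear `ψ₀ : x ↦ x + y^*_{inl 1}(x)·y_{inl 0}` and the plane transvections `ψ_i : x ↦ x + y^*_{(i,1)}(x)·y_{(i,0)}`,
`ψ'_i : x ↦ x − y^*_{(i,0)}(x)·y_{(i,1)}`, all REALISED in `Real.ind1StripOf v (galoisLog v)` (gen 12, BY NAME), such that for every subset `M ⊆ K_v`
and every additive subgroup `N` containing the images of `M` under `1, ψ₀, ψ_i, ψ'_i, ψ'_i ∘ ψ_i, ψ_i ∘ ψ'_i`: `y^*_{inl 1}(x)·y_{inl 0} ∈ N` and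
`y^*_{(i,ε)}(x)·y_{(i,ε')} ∈ N` for all `x ∈ M` (identities `ψ₀ x − x = y^*_{inl 1}(x) y_{inl 0}`, `ψ x − x = y^*_b(x) y_a`, `ψ' x − x = −y^*_a(x) y_b`,
`ψ'ψ x − ψ x = −(y^*_a(x) + y^*_b(x)) y_b`, `ψψ' x − ψ' x = (y^*_b(x) − y^*_a(x)) y_a`).
[claim: Mochizuki2012, status: disputed] [cite: Kondo2025OuterAutMLF, §2 proof of Thm 2.3 p.10] [cite: JannsenWingberg1982, §5.1 p.96]
[cite: HoshiNishio2022OuterAutMLF, Thm 1.5, Lemma 2.3 (ii) p.7] -/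
theorem exists_shear_planes_smul_mem_of_orbit (hJW : JannsenWingbergTwistsFirst)
    (p : ℕ) [Fact p.Prime] (hv : ((p : ℕ) : 𝓞 F) ∈ v.asIdeal) (hp2 : p ≠ 2) (h2 : 2 ≤ localDeg F v) (hev : Even (localDeg F v)) :
    ∃ (g : ℕ) (_ : localDeg F v = 2 + 2 * g) (y : Module.Basis (Fin 2 ⊕ Fin g × Fin 2) ℚ_[p] (RescaledCompletion F p v hv))
      (ψ₀ : v.adicCompletion F ≃+ v.adicCompletion F) (ψ ψ' : Fin g → (v.adicCompletion F ≃+ v.adicCompletion F)),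
      ψ₀ ∈ ind1StripOf v (galoisLog v) ∧ (∀ i, ψ i ∈ ind1StripOf v (galoisLog v)) ∧ (∀ i, ψ' i ∈ ind1StripOf v (galoisLog v)) ∧
      Algebra.trace ℚ_[p] (RescaledCompletion F p v hv) (y (Sum.inl 0)) = 0 ∧
      (∀ iε : Fin g × Fin 2, Algebra.trace ℚ_[p] (RescaledCompletion F p v hv) (y (Sum.inr iε)) = 0) ∧
      ∀ (M : Set (v.adicCompletion F)) (N : AddSubgroup (RescaledCompletion F p v hv)),
        (∀ x ∈ M, RescaledCompletion.of F p v hv x ∈ N) →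
        (∀ x ∈ M, RescaledCompletion.of F p v hv (ψ₀ x) ∈ N) →
        (∀ i, ∀ x ∈ M, RescaledCompletion.of F p v hv (ψ i x) ∈ N ∧ RescaledCompletion.of F p v hv (ψ' i x) ∈ N ∧
          RescaledCompletion.of F p v hv (ψ' i (ψ i x)) ∈ N ∧ RescaledCompletion.of F p v hv (ψ i (ψ' i x)) ∈ N) →
        (∀ x ∈ M, y.coord (Sum.inl 1) (RescaledCompletion.of F p v hv x) • y (Sum.inl 0) ∈ N) ∧
        ∀ i, ∀ x ∈ M, ∀ ε ε' : Fin 2,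
          y.coord (Sum.inr (i, ε)) (RescaledCompletion.of F p v hv x) • y (Sum.inr (i, ε')) ∈ N := by
  obtain ⟨g, hg, y, ψ₀, ψ, ψ', hψ₀, hψ, hψ', hT₀, hT, hT', htr0, htrp⟩ :=
    exists_realised_basis_trace_zero_of_jannsenWingbergFirst v hJW p hv hp2 h2 hev
  refine ⟨g, hg, y, ψ₀, ψ, ψ', hψ₀, hψ, hψ', htr0, htrp, fun M N hMN hsh horb => ⟨fun x hx => ?_, fun i x hx ε ε' => ?_⟩⟩
  · -- the shear: `ψ₀ x − x = y^*_{inl 1}(x) • y_{inl 0}`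
    set e := RescaledCompletion.of F p v hv with he
    have e0 : e (ψ₀ x) = e x + y.coord (Sum.inl 1) (e x) • y (Sum.inl 0) := by
      have h := hT₀ (e x)
      rwa [RingEquiv.symm_apply_apply] at h
    have h := N.sub_mem (hsh x hx) (hMN x hx)
    rwa [e0, add_sub_cancel_left] at h
  · set e := RescaledCompletion.of F p v hv with he
    obtain ⟨z, hz⟩ : ∃ z, e x = z := ⟨_, rfl⟩
    obtain ⟨α, hα⟩ : ∃ α, y.coord (Sum.inr (i, 0)) z = α := ⟨_, rfl⟩
    obtain ⟨β, hβ⟩ : ∃ β, y.coord (Sum.inr (i, 1)) z = β := ⟨_, rfl⟩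
    have hcoord : ∀ s t : Fin 2 ⊕ Fin g × Fin 2, y.coord s (y t) = if t = s then 1 else 0 := by
      intro s t
      rw [Module.Basis.coord_apply, Module.Basis.repr_self, Finsupp.single_apply]
    have h10 : (Sum.inr (i, (1 : Fin 2)) : Fin 2 ⊕ Fin g × Fin 2) ≠ Sum.inr (i, 0) := by simp
    have h01 : (Sum.inr (i, (0 : Fin 2)) : Fin 2 ⊕ Fin g × Fin 2) ≠ Sum.inr (i, 1) := by simp
    obtain ⟨hNψ, hNψ', hNψ'ψ, hNψψ'⟩ := horb i x hx
    have hzN : z ∈ N := hz ▸ hMN x hx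
    have e1 : e (ψ i x) = z + β • y (Sum.inr (i, 0)) := by
      have h := hT i z
      rwa [← hz, RingEquiv.symm_apply_apply, hz, hβ] at h
    have e2 : e (ψ' i x) = z - α • y (Sum.inr (i, 1)) := by
      have h := hT' i z
      rwa [← hz, RingEquiv.symm_apply_apply, hz, hα] at h
    have e3 : e (ψ' i (ψ i x)) = (z + β • y (Sum.inr (i, 0))) - (α + β) • y (Sum.inr (i, 1)) := by
      have h := hT' i (e (ψ i x))
      rw [RingEquiv.symm_apply_apply, e1, map_add, map_smul, hα, hcoord, if_pos rfl, smul_eq_mul, mul_one] at h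
      exact h
    have e4 : e (ψ i (ψ' i x)) = (z - α • y (Sum.inr (i, 1))) + (β - α) • y (Sum.inr (i, 0)) := by
      have h := hT i (e (ψ' i x))
      rw [RingEquiv.symm_apply_apply, e2, map_sub, map_smul, hβ, hcoord, if_pos rfl, smul_eq_mul, mul_one] at h
      exact h
    have hβa : β • y (Sum.inr (i, 0)) ∈ N := by
      have h := N.sub_mem hNψ hzN
      rwa [e1, add_sub_cancel_left] at h
    have hαb : α • y (Sum.inr (i, 1)) ∈ N := by
      have h := N.sub_mem hzN hNψ'
      rwa [e2, sub_sub_cancel] at h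
    have hβb : β • y (Sum.inr (i, 1)) ∈ N := by
      have h := N.sub_mem hNψ hNψ'ψ
      rw [e3, e1] at h
      have h' : (α + β) • y (Sum.inr (i, 1)) ∈ N := by convert h using 1; abel
      have h'' := N.sub_mem h' hαb
      rwa [add_smul, add_sub_cancel_left] at h''
    have hαa : α • y (Sum.inr (i, 0)) ∈ N := by
      have h := N.sub_mem hNψψ' hNψ'
      rw [e4, e2] at h
      have h' : (β - α) • y (Sum.inr (i, 0)) ∈ N := by convert h using 1; abel
      have h'' := N.sub_mem hβa h'
      rwa [sub_smul, sub_sub_cancel] at h''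
    rw [hz]
    revert ε ε'
    simp only [Fin.forall_fin_two]
    rw [hα, hβ]
    exact ⟨⟨hαa, hαb⟩, hβa, hβb⟩


/-! ## 2. At the BAD PLACES of a genuine initial Θ-datum ([IUTchI] Def. 3.1): the orbit span by parity of `[K_w : ℚ_p]` -/

section GenuineK

open Literature.IUT.HodgeTheaters Cor312Prov

variable {K₀ Fbar : Type} [Field K₀] [NumberField K₀] [Algebra F K₀] [Field Fbar]
  [Algebra F Fbar] [Algebra K₀ Fbar] {E : WeierstrassCurve F} [E.IsElliptic] {l : ℕ} {Pb : BadPlacePredicates K₀}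
  (D : InitialThetaData F K₀ Fbar E l Pb)

/-- **THE ORBIT SPAN OF PRINT's (Ind1) STRIP PART AT EVERY BAD PLACE OF A GENUINE INITIAL Θ-DATUM, by parity.**  For an initial Θ-datum `D`
([IUTchI] Def. 3.1, abc-iut-L5-t2's faithful structure) and a place `w` of `K = F(E_F[l])` in the bad set of the `K`-level Dupuy–Hilado pilot datum
(abc-iut-C-cert-3 `pilotDataOfK`), over the prime `p` under `w` — where `p ≠ 2` and `[K_w : ℚ_p] ≥ 5` are AUTOMATIC (R16
`residueChar_ne_two_of_mem_S_pilotDataOfK`, `five_le_localDeg_of_mem_S_pilotDataOfK`; these are the only finite places where [IUTchIII] Cor. 3.12's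
Θ-regions are not the log-shell itself):
* `[K_w : ℚ_p]` EVEN (modulo `JannsenWingbergTwistsFirst`): the data of `exists_shear_planes_smul_mem_of_orbit` — shear + plane reach;
* `[K_w : ℚ_p]` ODD (modulo `JannsenWingbergTwists`): the data of `exists_planes_smul_mem_of_orbit` (R17b) — plane reach, planes spanning `Ker Tr`.
In both cases the reach is trace-zero and lies inside the unconditional ceiling `M + c·(log_p(𝒪_w^×) ∩ Ker Tr)` (R17b §1).
[claim: Mochizuki2012, status: disputed] [cite: Kondo2025OuterAutMLF, §2 Thm 2.3 and proof p.10] [cite: DupuyHilado2025, §3.3, §4.9] -/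
theorem orbitSpan_at_bad_of_jannsenWingberg (hJW : JannsenWingbergTwists) (hJW₁ : JannsenWingbergTwistsFirst)
    {w : HeightOneSpectrum (𝓞 K₀)} (hS : w ∈ (pilotDataOfK D K₀).S)
    (p : ℕ) [Fact p.Prime] (hw : ((p : ℕ) : 𝓞 K₀) ∈ w.asIdeal) :
    5 ≤ localDeg K₀ w ∧
    (Even (localDeg K₀ w) →
      ∃ (g : ℕ) (_ : localDeg K₀ w = 2 + 2 * g) (y : Module.Basis (Fin 2 ⊕ Fin g × Fin 2) ℚ_[p] (RescaledCompletion K₀ p w hw))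
        (ψ₀ : w.adicCompletion K₀ ≃+ w.adicCompletion K₀) (ψ ψ' : Fin g → (w.adicCompletion K₀ ≃+ w.adicCompletion K₀)),
        ψ₀ ∈ ind1StripOf w (galoisLog w) ∧ (∀ i, ψ i ∈ ind1StripOf w (galoisLog w)) ∧ (∀ i, ψ' i ∈ ind1StripOf w (galoisLog w)) ∧
        Algebra.trace ℚ_[p] (RescaledCompletion K₀ p w hw) (y (Sum.inl 0)) = 0 ∧
        (∀ iε : Fin g × Fin 2, Algebra.trace ℚ_[p] (RescaledCompletion K₀ p w hw) (y (Sum.inr iε)) = 0) ∧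
        ∀ (M : Set (w.adicCompletion K₀)) (N : AddSubgroup (RescaledCompletion K₀ p w hw)),
          (∀ x ∈ M, RescaledCompletion.of K₀ p w hw x ∈ N) →
          (∀ x ∈ M, RescaledCompletion.of K₀ p w hw (ψ₀ x) ∈ N) →
          (∀ i, ∀ x ∈ M, RescaledCompletion.of K₀ p w hw (ψ i x) ∈ N ∧ RescaledCompletion.of K₀ p w hw (ψ' i x) ∈ N ∧
            RescaledCompletion.of K₀ p w hw (ψ' i (ψ i x)) ∈ N ∧ RescaledCompletion.of K₀ p w hw (ψ i (ψ' i x)) ∈ N) →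
          (∀ x ∈ M, y.coord (Sum.inl 1) (RescaledCompletion.of K₀ p w hw x) • y (Sum.inl 0) ∈ N) ∧
          ∀ i, ∀ x ∈ M, ∀ ε ε' : Fin 2,
            y.coord (Sum.inr (i, ε)) (RescaledCompletion.of K₀ p w hw x) • y (Sum.inr (i, ε')) ∈ N) ∧
    (Odd (localDeg K₀ w) →
      ∃ (g : ℕ) (_ : localDeg K₀ w = 1 + 2 * g) (y : Module.Basis (Fin 1 ⊕ Fin g × Fin 2) ℚ_[p] (RescaledCompletion K₀ p w hw))
        (ψ ψ' : Fin g → (w.adicCompletion K₀ ≃+ w.adicCompletion K₀)),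
        (∀ i, ψ i ∈ ind1StripOf w (galoisLog w)) ∧ (∀ i, ψ' i ∈ ind1StripOf w (galoisLog w)) ∧
        (∀ iε : Fin g × Fin 2, Algebra.trace ℚ_[p] (RescaledCompletion K₀ p w hw) (y (Sum.inr iε)) = 0) ∧
        Submodule.span ℚ_[p] (Set.range fun iε : Fin g × Fin 2 => y (Sum.inr iε)) =
          LinearMap.ker (Algebra.trace ℚ_[p] (RescaledCompletion K₀ p w hw)) ∧
        Algebra.trace ℚ_[p] (RescaledCompletion K₀ p w hw) (y (Sum.inl 0)) ≠ 0 ∧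
        ∀ (M : Set (w.adicCompletion K₀)) (N : AddSubgroup (RescaledCompletion K₀ p w hw)),
          (∀ x ∈ M, RescaledCompletion.of K₀ p w hw x ∈ N) →
          (∀ i, ∀ x ∈ M, RescaledCompletion.of K₀ p w hw (ψ i x) ∈ N ∧ RescaledCompletion.of K₀ p w hw (ψ' i x) ∈ N ∧
            RescaledCompletion.of K₀ p w hw (ψ' i (ψ i x)) ∈ N ∧ RescaledCompletion.of K₀ p w hw (ψ i (ψ' i x)) ∈ N) →
          ∀ i, ∀ x ∈ M, ∀ ε ε' : Fin 2,
            y.coord (Sum.inr (i, ε)) (RescaledCompletion.of K₀ p w hw x) • y (Sum.inr (i, ε')) ∈ N) := by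
  have h5 := five_le_localDeg_of_mem_S_pilotDataOfK D hS
  have hp2 := residueChar_ne_two_of_mem_S_pilotDataOfK D hS hw
  refine ⟨h5, fun hev => ?_, fun hodd => ?_⟩
  · exact exists_shear_planes_smul_mem_of_orbit w hJW₁ p hw hp2 ((show 2 ≤ 5 by norm_num).trans h5) hev
  · exact exists_planes_smul_mem_of_orbit w hJW p hw hp2 ((show 3 ≤ 5 by norm_num).trans h5) hodd

end GenuineK

end Summit.ABC.IUTFork.Thm311.Real

end
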